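import Summits.RiemannHypothesis.RiemannHypothesis.Theses.WeilComb
import Summits.RiemannHypothesis.RiemannHypothesis.Theorems.WeilCombCombShapeAdmissible
import Literature.NumberTheory.LFunctions.WeilExplicit
import Literature.NumberTheory.LFunctions.WeilMellinBounds
import Literature.NumberTheory.LFunctions.WeilArchimedeanMoments
import Literature.NumberTheory.LFunctions.WeilArchimedeanPositivityProofs

/-!
# Sub-goal `weilArchTerm_psi_diag` of stub `stub_window` (line `Sketch`) for crux
`WeilComb.CombShapePositivity` (item stmt-RiemannHypothesis-11229, route route-RiemannHypothesis-WeilComb)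

The archimedean kernel of the fixed-shape comb ON THE DIAGONAL, in closed (digamma) form.
Notation: `φ₀(u) = expNegInvGlue (1 - u²)` (the route's fixed bump, a Weil test by
`weilComb_shapeBump_isWeilTest`), `φ_ε(t) = ε⁻¹ φ₀(t/ε)`, `ψ_ε = φ_ε ⋆ φ̃_ε`
(`weilConv` / `weilReflect`), `ĥ = weilMellin h`, `ĥ(s) = ∫ h(t) e^{(s - 1/2) t} dt`,
`W_∞ = weilArchTerm`, `‖h‖₂² = weilNorm2Sq h`.

**Statement.** For `ε > 0`,
`W_∞(ψ_ε) = (1/2π) ∫ |φ̂₀(1/2 + iεt)|² Re ψ(1/4 + it/2) dt − ε⁻¹ ‖φ₀‖₂² log π`.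

**Proof.** By definition `W_∞(g) = (1/2π) · weilArchIntegral g − g(0) log π`, and for a Weil test
`h`, `weilArchIntegral (h ⋆ h̃) = ∫ |ĥ(1/2 + it)|² Re ψ(1/4 + it/2) dt`
(`weilArchIntegral_weilConv_weilReflect`) and `(h ⋆ h̃)(0) = ‖h‖₂²`
(`weilConv_weilReflect_apply_zero`). With `h = φ_ε`: the substitution `t = ε u`
(`MeasureTheory.Measure.integral_comp_div`) gives `φ̂_ε(1/2 + it) = φ̂₀(1/2 + iεt)` and
`‖φ_ε‖₂² = ε⁻¹ ‖φ₀‖₂²`.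
-/

noncomputable section

-- the sub-problem path RiemannHypothesis/RiemannHypothesis duplicates a namespace (D-0017)
set_option linter.dupNamespace false

open scoped BigOperators ComplexConjugate
open Complex MeasureTheory Set

namespace Summit.RiemannHypothesis.RiemannHypothesis.Theorems.WeilCombBohrFejer

open Literature.NumberTheory.LFunctions

/-- `φ_ε = ε⁻¹ φ(·/ε)` is a Weil test function for `ε ≠ 0` (smoothness of `t ↦ t/ε`; the support is
the image of a compact set under the homeomorphism `t ↦ ε t`). [folklore] -/
private theorem isWeilTest_dil_archDiag {φ : ℝ → ℂ} {ε : ℝ} (hφ : IsWeilTest φ) (hε : ε ≠ 0) :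
    IsWeilTest (fun t : ℝ => (ε : ℂ)⁻¹ * φ (t / ε)) := by
  -- adapted from `WeilCombBohrFejer.isWeilTest_dil` in `StubGram` (private there)
  have h1 : IsWeilTest (fun t : ℝ => φ (t / ε)) := by
    refine ⟨hφ.1.comp (contDiff_id.div_const ε), ?_⟩
    have e : (fun t : ℝ => φ (t / ε)) = φ ∘ (Homeomorph.mulRight₀ ε⁻¹ (inv_ne_zero hε)) := by
      ext t
      simp [div_eq_mul_inv]
    rw [e]
    exact hφ.2.comp_homeomorph _
  exact h1.const_mul _

/-- `ψ_ε(0) = ‖φ_ε‖₂² = ε⁻¹ ‖φ‖₂²` (`ε > 0`): `(h ⋆ h̃)(0) = ∫ |h|²` and the dilation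
`∫ |ε⁻¹ φ(t/ε)|² dt = ε⁻² · ε ∫ |φ|²`. [folklore] -/
private theorem psi_zero_archDiag (φ : ℝ → ℂ) {ε : ℝ} (hε : 0 < ε) :
    weilConv (fun t : ℝ => (ε : ℂ)⁻¹ * φ (t / ε))
        (weilReflect (fun t : ℝ => (ε : ℂ)⁻¹ * φ (t / ε))) 0 = ((ε⁻¹ * weilNorm2Sq φ : ℝ) : ℂ) := by
  -- adapted from `WeilCombSubcritical.psi_zero_prime` in `StubPrime` (private there)
  rw [weilConv_weilReflect_apply_zero]
  congr 1
  show (∫ t : ℝ, ‖(ε : ℂ)⁻¹ * φ (t / ε)‖ ^ 2) = ε⁻¹ * weilNorm2Sq φ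
  have e : (fun t : ℝ => ‖(ε : ℂ)⁻¹ * φ (t / ε)‖ ^ 2) = fun t => ε⁻¹ ^ 2 * ‖φ (t / ε)‖ ^ 2 := by
    funext t
    rw [norm_mul, norm_inv, Complex.norm_real, Real.norm_eq_abs, abs_of_pos hε, mul_pow]
  rw [e, integral_const_mul, Measure.integral_comp_div (fun t => ‖φ t‖ ^ 2) ε, abs_of_pos hε,
    smul_eq_mul]
  unfold weilNorm2Sq
  rw [← mul_assoc, sq, mul_assoc ε⁻¹, inv_mul_cancel₀ hε.ne', mul_one]

/-- Dilation substitution `t = ε u` (`ε > 0`): `φ̂_ε(s) = ∫ φ(u) e^{(s - 1/2) ε u} du`, the factor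
`ε⁻¹ · |ε|` cancelling. [folklore] -/
private theorem weilMellin_dil_archDiag (φ : ℝ → ℂ) {ε : ℝ} (hε : 0 < ε) (s : ℂ) :
    weilMellin (fun t : ℝ => (ε : ℂ)⁻¹ * φ (t / ε)) s =
      ∫ u : ℝ, φ u * cexp ((s - 1 / 2) * ((ε * u : ℝ) : ℂ)) := by
  -- adapted from `WeilCombBohrFejer.weilMellin_dilShapeBump` in `PoleCoefficient` (private there)
  unfold weilMellin
  have hεC : (ε : ℂ) ≠ 0 := Complex.ofReal_ne_zero.2 hε.ne'
  have h1 : (fun t : ℝ => (ε : ℂ)⁻¹ * φ (t / ε) * cexp ((s - 1 / 2) * (t : ℂ))) =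
      fun t : ℝ => (ε : ℂ)⁻¹ *
        ((fun u : ℝ => φ u * cexp ((s - 1 / 2) * ((ε * u : ℝ) : ℂ))) (t / ε)) := by
    funext t
    simp only [mul_div_cancel₀ t hε.ne', mul_assoc]
  rw [h1, integral_const_mul,
    Measure.integral_comp_div (fun u : ℝ => φ u * cexp ((s - 1 / 2) * ((ε * u : ℝ) : ℂ))) ε,
    abs_of_pos hε, Complex.real_smul, ← mul_assoc, inv_mul_cancel₀ hεC, one_mul]

/-- Dilation on the critical line: `φ̂_ε(1/2 + it) = φ̂(1/2 + iεt)` (`ε > 0`), i.e. the Fourier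
transform of `ε⁻¹ φ(·/ε)` at `t` is that of `φ` at `ε t`. [folklore] -/
private theorem weilMellin_dil_half_archDiag (φ : ℝ → ℂ) {ε : ℝ} (hε : 0 < ε) (t : ℝ) :
    weilMellin (fun x : ℝ => (ε : ℂ)⁻¹ * φ (x / ε)) (1 / 2 + t * I) =
      weilMellin φ (1 / 2 + (ε * t) * I) := by
  rw [weilMellin_dil_archDiag φ hε]
  unfold weilMellin
  congr 1
  funext u
  congr 2
  push_cast
  ring

/-- **Sub-goal (d) of `stub_window`: the arch kernel on the diagonal, in closed form.** For
`ε > 0`, `W_∞(ψ_ε) = (1/2π) ∫ |φ̂₀(1/2 + iεt)|² Re ψ(1/4 + it/2) dt − ε⁻¹ ‖φ₀‖₂² log π`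
(`weilArchTerm` unfolded, `weilArchIntegral_weilConv_weilReflect`,
`weilConv_weilReflect_apply_zero`, and the dilation `t = ε u` in `φ̂_ε` and in `‖φ_ε‖₂²`).
[folklore] -/
theorem weilArchTerm_psi_diag : ∀ ε : ℝ, 0 < ε →
    weilArchTerm
        (weilConv (fun t : ℝ => (ε : ℂ)⁻¹ * ((expNegInvGlue (1 - (t / ε) ^ 2) : ℝ) : ℂ))
          (weilReflect (fun t : ℝ => (ε : ℂ)⁻¹ * ((expNegInvGlue (1 - (t / ε) ^ 2) : ℝ) : ℂ)))) =
      (1 / (2 * Real.pi) : ℂ) *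
          ((∫ t : ℝ, ‖weilMellin (fun u : ℝ => ((expNegInvGlue (1 - u ^ 2) : ℝ) : ℂ))
              (1 / 2 + (ε * t) * I)‖ ^ 2 * (Complex.digamma (1 / 4 + t / 2 * I)).re : ℝ) : ℂ) -
        ((ε⁻¹ * weilNorm2Sq (fun u : ℝ => ((expNegInvGlue (1 - u ^ 2) : ℝ) : ℂ)) : ℝ) : ℂ) *
          (Real.log Real.pi : ℂ) := by
  intro ε hε
  -- the fixed bump `φ₀` is a Weil test, hence so is `φ_ε`
  have hφ : IsWeilTest (fun u : ℝ => ((expNegInvGlue (1 - u ^ 2) : ℝ) : ℂ)) :=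
    Summit.RiemannHypothesis.RiemannHypothesis.Theorems.weilComb_shapeBump_isWeilTest
  have hdil : IsWeilTest (fun t : ℝ => (ε : ℂ)⁻¹ * ((expNegInvGlue (1 - (t / ε) ^ 2) : ℝ) : ℂ)) :=
    isWeilTest_dil_archDiag (φ := fun u : ℝ => ((expNegInvGlue (1 - u ^ 2) : ℝ) : ℂ)) hφ hε.ne'
  -- `ψ_ε(0) = ε⁻¹ ‖φ₀‖₂²`
  have hpsi0 : weilConv (fun t : ℝ => (ε : ℂ)⁻¹ * ((expNegInvGlue (1 - (t / ε) ^ 2) : ℝ) : ℂ))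
      (weilReflect (fun t : ℝ => (ε : ℂ)⁻¹ * ((expNegInvGlue (1 - (t / ε) ^ 2) : ℝ) : ℂ))) 0 =
      ((ε⁻¹ * weilNorm2Sq (fun u : ℝ => ((expNegInvGlue (1 - u ^ 2) : ℝ) : ℂ)) : ℝ) : ℂ) :=
    psi_zero_archDiag (fun u : ℝ => ((expNegInvGlue (1 - u ^ 2) : ℝ) : ℂ)) hε
  -- `φ̂_ε(1/2 + it) = φ̂₀(1/2 + iεt)`
  have hmel : ∀ t : ℝ,
      weilMellin (fun x : ℝ => (ε : ℂ)⁻¹ * ((expNegInvGlue (1 - (x / ε) ^ 2) : ℝ) : ℂ))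
          (1 / 2 + t * I) =
        weilMellin (fun u : ℝ => ((expNegInvGlue (1 - u ^ 2) : ℝ) : ℂ)) (1 / 2 + (ε * t) * I) :=
    fun t => weilMellin_dil_half_archDiag (fun u : ℝ => ((expNegInvGlue (1 - u ^ 2) : ℝ) : ℂ)) hε t
  have hI : (∫ t : ℝ, ‖weilMellin
        (fun x : ℝ => (ε : ℂ)⁻¹ * ((expNegInvGlue (1 - (x / ε) ^ 2) : ℝ) : ℂ)) (1 / 2 + t * I)‖ ^ 2 *
          (Complex.digamma (1 / 4 + t / 2 * I)).re) =
      ∫ t : ℝ, ‖weilMellin (fun u : ℝ => ((expNegInvGlue (1 - u ^ 2) : ℝ) : ℂ))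
          (1 / 2 + (ε * t) * I)‖ ^ 2 * (Complex.digamma (1 / 4 + t / 2 * I)).re := by
    congr 1
    funext t
    rw [hmel t]
  unfold weilArchTerm
  rw [weilArchIntegral_weilConv_weilReflect hdil, hpsi0, hI]

end Summit.RiemannHypothesis.RiemannHypothesis.Theorems.WeilCombBohrFejer

end
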